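import Mathlib.Topology.Algebra.Category.ProfiniteGrp.Completion
import Mathlib.Topology.Algebra.Group.TopologicalAbelianization
import Mathlib.Topology.MetricSpace.Ultra.TotallySeparated
import Mathlib.NumberTheory.Padics.ProperSpace
import Literature.AnabelianGeometry.AbsoluteAnabelian.ProfiniteRankProofs
import HarnessLib

/-!
# The free pro-`l` rank `δ¹_l` of a topological abelianization and of a profinite completion

Proof-only companion of `ProfiniteTerminology.lean` (abc-iut-L4-t4, p403895; `freeProlRank G l` =
the supremum of the `n` with a continuous surjection `G ↠ ℤ_lⁿ`, the elementary form of
`δ¹_l(G) = dim_{ℚ_l} H¹(G, ℚ_l)` of S. Mochizuki, *Topics in Absolute Anabelian Geometry I* (2012)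
[AbsTopI] Thm 2.6 and *The Absolute Anabelian Geometry of Hyperbolic Curves* (2004) [AbsAnab]
Lemma 1.1.4 (ii)).  It supplies the two pieces of plumbing through which the rank formula
`δ¹_l(G_k) = 1 (l ≠ p)`, `δ¹_p(G_k) = [k : ℚ_p] + 1` of [AbsTopI] Thm 2.6 (ii) (p. 21, "the
well-known fact"; the named fact `FundamentalExtension.thm26_ii_delta_gal`) is reduced to a
statement about the multiplicative group `k^×` via local class field theory
`(k^×)^∧ ≅ G_k^{ab}` ([AbsAnab] §1.2 p. 9; named fact `mlf_reciprocity_completion`):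

* `freeProlRank_topologicalAbelianization` — `δ¹_l(G) = δ¹_l(G^{ab})` where
  `G^{ab} = G / closure([G, G])` is Mathlib's `TopologicalAbelianization`: a continuous surjection
  onto the abelian Hausdorff group `ℤ_lⁿ` kills the closed commutator subgroup and descends
  continuously through the open quotient map;
* `freeProlRank_profiniteCompletion` — for an abstract group `A` with profinite completion
  `A^∧` (Mathlib `ProfiniteGrp.ProfiniteCompletion.completion`, the limit over ALL finite-index
  normal subgroups), `δ¹_l(A^∧) = sup {n : ∃ f : A → ℤ_lⁿ a homomorphism with dense image}`:
  continuous homomorphisms `A^∧ → ℤ_lⁿ` correspond to homomorphisms `A → ℤ_lⁿ` by the universal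
  property (`ProfiniteCompletion.lift`, `lift_eta`), and surjectivity corresponds to density of
  the image because `η(A)` is dense in `A^∧` (`ProfiniteCompletion.denseRange`) and continuous
  images of the compact `A^∧` are closed;
* on the way: the unfolding lemmas `le_freeProlRank_of_surjective`, `freeProlRank_le_of_forall`
  (monotonicity under continuous surjections is abc-iut-L4-t11's `freeProlRank_le_of_surjective`,
  `ProfiniteRankProofs.lean`, imported).

Everything here is elementary topological group theory over Mathlib; theorems only (no
definitions, no named facts).  HONEST FRAMING: classical and undisputed; nothing here bears on
[IUTchIII] Cor. 3.12.
-/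

noncomputable section

open CategoryTheory Topology

universe u

namespace Literature.AnabelianGeometry.AbsoluteAnabelian

/-! ### Unfolding the supremum -/

section Unfold

variable {G : Type u} [Group G] [TopologicalSpace G]

/-- A continuous surjection `G ↠ ℤ_lⁿ` witnesses `n ≤ δ¹_l(G)` (unfolding of the typed `δ¹_l`).
[cite: MochizukiAbsTopI2012, Thm 2.6 p.21] -/
theorem le_freeProlRank_of_surjective (l : ℕ) [Fact l.Prime] {n : ℕ}
    (f : G →ₜ* Multiplicative (Fin n → ℤ_[l])) (hf : Function.Surjective f) :
    (n : ℕ∞) ≤ freeProlRank G l := by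
  unfold freeProlRank
  exact le_iSup₂_of_le n ⟨f, hf⟩ le_rfl

/-- `δ¹_l(G) ≤ N` as soon as every continuous surjection `G ↠ ℤ_lⁿ` has `n ≤ N` (unfolding of the
typed `δ¹_l`). [cite: MochizukiAbsTopI2012, Thm 2.6 p.21] -/
theorem freeProlRank_le_of_forall (l : ℕ) [Fact l.Prime] {N : ℕ∞}
    (h : ∀ (n : ℕ) (f : G →ₜ* Multiplicative (Fin n → ℤ_[l])), Function.Surjective f →
      (n : ℕ∞) ≤ N) :
    freeProlRank G l ≤ N := by
  unfold freeProlRank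
  refine iSup₂_le fun n hn => ?_
  obtain ⟨f, hf⟩ := hn
  exact h n f hf

end Unfold

/-! ### `δ¹_l` of the topological abelianization -/

section Abelianization

variable {G : Type u} [Group G] [TopologicalSpace G] [IsTopologicalGroup G]

/-- A continuous homomorphism from `G` to the abelian Hausdorff group `ℤ_lⁿ` kills the closure of
the commutator subgroup. [folklore] -/
private theorem topologicalClosure_commutator_le_ker (l : ℕ) [Fact l.Prime] {n : ℕ}
    (f : G →ₜ* Multiplicative (Fin n → ℤ_[l])) :
    (commutator G).topologicalClosure ≤ f.toMonoidHom.ker := by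
  refine Subgroup.topologicalClosure_minimal _ (Abelianization.commutator_subset_ker _) ?_
  change IsClosed (f ⁻¹' {1})
  exact (isClosed_singleton).preimage f.continuous

/-- **`δ¹_l(G^{ab}) = δ¹_l(G)`** for the topological abelianization `G^{ab} = G / closure([G,G])`:
`≤` by composing with the quotient map, `≥` because every continuous surjection `G ↠ ℤ_lⁿ`
factors continuously through `G^{ab}` (the quotient map is open).  This is the step
"`δ¹_l(G) = dim(G^{ab} ⊗ ℚ_l)`" implicit in [AbsAnab] Lemma 1.1.4 (ii) / [AbsTopI] Thm 2.6.
[cite: MochizukiAbsTopI2012, Thm 2.6 p.21] -/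
theorem freeProlRank_topologicalAbelianization (l : ℕ) [Fact l.Prime] :
    freeProlRank (TopologicalAbelianization G) l = freeProlRank G l := by
  refine le_antisymm ?_ ?_
  · -- the quotient map is a continuous surjection
    let q : G →ₜ* TopologicalAbelianization G :=
      { toMonoidHom := QuotientGroup.mk' (commutator G).topologicalClosure
        continuous_toFun := QuotientGroup.continuous_mk }
    exact freeProlRank_le_of_surjective q (QuotientGroup.mk'_surjective _) l
  · refine freeProlRank_le_of_forall l fun n f hf => ?_
    have hle := topologicalClosure_commutator_le_ker l f
    let g₀ : TopologicalAbelianization G →* Multiplicative (Fin n → ℤ_[l]) :=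
      QuotientGroup.lift (commutator G).topologicalClosure f.toMonoidHom hle
    have hg₀ : Continuous g₀ := by
      have hcomp : Continuous (g₀ ∘ (QuotientGroup.mk : G → TopologicalAbelianization G)) :=
        f.continuous
      exact (QuotientGroup.isOpenQuotientMap_mk.continuous_comp_iff).mp hcomp
    let g : TopologicalAbelianization G →ₜ* Multiplicative (Fin n → ℤ_[l]) :=
      { toMonoidHom := g₀, continuous_toFun := hg₀ }
    have hgs : Function.Surjective g := by
      intro y
      obtain ⟨x, rfl⟩ := hf y
      exact ⟨QuotientGroup.mk x, rfl⟩
    exact le_freeProlRank_of_surjective l g hgs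

end Abelianization

/-! ### `δ¹_l` of a profinite completion -/

section Completion

variable (A : Type) [Group A]

/-- For the profinite completion `A^∧` of an abstract group `A` (limit over all finite-index
normal subgroups): if `f : A → ℤ_lⁿ` is a homomorphism with dense image, its continuous extension
`A^∧ → ℤ_lⁿ` (universal property) is surjective, so `n ≤ δ¹_l(A^∧)` — the form in which
`(k^×)^∧ ≅ G_k^{ab}` ([AbsAnab] §1.2 p. 9) feeds rank computations.
[cite: MochizukiAbsAnab2004, §1.2 p.9] -/
theorem le_freeProlRank_profiniteCompletion_of_denseRange (l : ℕ) [Fact l.Prime] {n : ℕ}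
    (f : A →* Multiplicative (Fin n → ℤ_[l])) (hf : DenseRange f) :
    (n : ℕ∞) ≤ freeProlRank (ProfiniteGrp.ProfiniteCompletion.completion (GrpCat.of A)) l := by
  classical
  let P : ProfiniteGrp.{0} := ProfiniteGrp.of (Multiplicative (Fin n → ℤ_[l]))
  let G : GrpCat.{0} := GrpCat.of A
  let φ : G ⟶ GrpCat.of P := GrpCat.ofHom f
  let ê := ProfiniteGrp.ProfiniteCompletion.lift φ
  have hê_eta : ∀ x : A, ê.hom (ProfiniteGrp.ProfiniteCompletion.etaFn G x) = f x := by
    intro x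
    have h := ConcreteCategory.congr_hom (ProfiniteGrp.ProfiniteCompletion.lift_eta φ) x
    simp only [GrpCat.comp_apply] at h
    exact h
  let F : ProfiniteGrp.ProfiniteCompletion.completion G →ₜ* Multiplicative (Fin n → ℤ_[l]) :=
    ê.hom
  have hFc : Continuous F := F.continuous
  -- surjectivity: closed (compact) image containing the dense `f(A)`
  have hsurj : Function.Surjective F := by
    have hclosed : IsClosed (Set.range F) := (isCompact_range hFc).isClosed
    have hsub : Set.range f ⊆ Set.range F := by
      rintro _ ⟨x, rfl⟩
      exact ⟨ProfiniteGrp.ProfiniteCompletion.etaFn G x, hê_eta x⟩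
    have hdense : Dense (Set.range F) := hf.mono hsub
    exact Set.range_eq_univ.mp (by rw [← hclosed.closure_eq, hdense.closure_eq])
  exact le_freeProlRank_of_surjective l F hsurj

/-- Conversely, a continuous surjection `A^∧ ↠ ℤ_lⁿ` restricts along `η : A → A^∧` to a
homomorphism `A → ℤ_lⁿ` with dense image (`η(A)` is dense in `A^∧`). [folklore] -/
private theorem exists_denseRange_of_surjective (l : ℕ) [Fact l.Prime] {n : ℕ}
    (F : ProfiniteGrp.ProfiniteCompletion.completion (GrpCat.of A) →ₜ*
      Multiplicative (Fin n → ℤ_[l])) (hF : Function.Surjective F) :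
    ∃ f : A →* Multiplicative (Fin n → ℤ_[l]), DenseRange f := by
  refine ⟨F.toMonoidHom.comp (ProfiniteGrp.ProfiniteCompletion.eta (GrpCat.of A)).hom, ?_⟩
  have h : DenseRange (F ∘ ProfiniteGrp.ProfiniteCompletion.etaFn (GrpCat.of A)) :=
    hF.denseRange.comp (ProfiniteGrp.ProfiniteCompletion.denseRange (GrpCat.of A)) F.continuous
  exact h

/-- **`δ¹_l(A^∧) = sup {n : A` has a homomorphism to `ℤ_lⁿ` with dense image`}`** for the
profinite completion `A^∧` of an abstract group `A`.  With `A = k^×` and local class field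
theory `(k^×)^∧ ≅ G_k^{ab}` ([AbsAnab] §1.2 p. 9) this turns [AbsTopI] Thm 2.6 (ii)'s
`δ¹_l(G_k)` into a statement about homomorphisms `k^× → ℤ_lⁿ`.
[cite: MochizukiAbsAnab2004, §1.2 p.9] -/
theorem freeProlRank_profiniteCompletion (l : ℕ) [Fact l.Prime] :
    freeProlRank (ProfiniteGrp.ProfiniteCompletion.completion (GrpCat.of A)) l =
      ⨆ (n : ℕ) (_ : ∃ f : A →* Multiplicative (Fin n → ℤ_[l]), DenseRange f), (n : ℕ∞) := by
  refine le_antisymm ?_ ?_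
  · refine freeProlRank_le_of_forall l fun n F hF => ?_
    exact le_iSup₂_of_le n (exists_denseRange_of_surjective A l F hF) le_rfl
  · refine iSup₂_le fun n hn => ?_
    obtain ⟨f, hf⟩ := hn
    exact le_freeProlRank_profiniteCompletion_of_denseRange A l f hf

/-- Handy bound form: if every homomorphism `A → ℤ_lⁿ` with dense image has `n ≤ N`, then
`δ¹_l(A^∧) ≤ N`. [cite: MochizukiAbsAnab2004, §1.2 p.9] -/
theorem freeProlRank_profiniteCompletion_le_of_forall (l : ℕ) [Fact l.Prime] {N : ℕ∞}
    (h : ∀ (n : ℕ) (f : A →* Multiplicative (Fin n → ℤ_[l])), DenseRange f → (n : ℕ∞) ≤ N) :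
    freeProlRank (ProfiniteGrp.ProfiniteCompletion.completion (GrpCat.of A)) l ≤ N := by
  rw [freeProlRank_profiniteCompletion]
  refine iSup₂_le fun n hn => ?_
  obtain ⟨f, hf⟩ := hn
  exact h n f hf

end Completion

end Literature.AnabelianGeometry.AbsoluteAnabelian
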